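import Literature.Computability.Complexity.IrreducibilityLLLPolyArithFP
import Literature.Computability.Complexity.IrreducibilityLLLGcd
import HarnessLib

/-!
# The extended Euclidean algorithm modulo `p` runs in polynomial time (`CodeFP`)

Support file for the discharge of the named fact
`Literature.Computability.Complexity.lll_monicIrreducible_mem_P` (irreducibility of monic integer
polynomials is decidable in `P`; Lenstra–Lenstra–Lovász 1982, §3). Machine side of
`IrreducibilityLLLGcd.lean`, in the typed `FP` algebra `CodeFP`. The prime `p` of LLL82 (3.6) is
polynomially bounded in VALUE, and the loop of `invMod` (Fermat) runs `p - 2` times, so `p` is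
carried as a UNARY numeral (`unE`); every modulus entering a reduction is `p⁺ = max p 2` (the
identity on primes), which keeps all accumulator bounds true on every input:

* `powModC`, `invModC`, `monicizerC`, `monicizeC`, `xgcdStepC`;
* the unconditional invariants of the Euclidean loop (`XSize`: reducedness, `|rᵢ| ≤ R`,
  `|sᵢ|, |tᵢ| ≤ S` with `S ← S + R + 1` per step), and **`pxgcdC`**:
  `(p, a, b) ↦ pxgcd p⁺ a b` on codes (fold over `|b| + 1` ticks, accumulator `≤ 500 (L+1)⁴`);
  `pgcdC`.

## References

* S. Arora, B. Barak, *Computational Complexity: A Modern Approach*, CUP 2009, §1.3. [AroraBarak2009]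
* D. E. Knuth, *The Art of Computer Programming*, Vol. 2, §4.6.1 (Euclid's algorithm for
  polynomials over a field). [KnuthTAOCP2]
* A. K. Lenstra, H. W. Lenstra Jr., L. Lovász, Math. Ann. 261 (1982), §3, proof of (3.6). [LenstraLenstraLovasz1982]
-/

noncomputable section

namespace Literature.Computability.Complexity

open Polynomial SumcheckMA CodeFP Brick _root_.Computability

namespace LLLFactoring

/-! ### Fermat inverses -/

/-- `powMod` keeps its accumulator reduced after the first step (`p ≥ 1`), and `1` before. [folklore] -/
theorem powMod_bounds' {p : ℕ} (hp : 0 < p) (c : ℤ) (e : ℕ) : (0 ≤ powMod p c e ∧ powMod p c e < p) ∨ powMod p c e = 1 := by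
  rcases Nat.eq_zero_or_pos e with rfl | he
  · right; rfl
  · left; exact powMod_bounds hp c he

/-- The code of a small integer: `|intE z| ≤ 3 size |z| + 2`. [folklore] -/
theorem length_intE_le (z : ℤ) : (intE z).length ≤ 3 * Nat.size z.natAbs + 2 := length_dpEnc_le z

/-- The code of a reduced residue modulo `M⁺`: `≤ 3 size M + 8`. [folklore] -/
theorem length_intE_le_of_lt_max {M : ℕ} {z : ℤ} (h0 : 0 ≤ z) (hz : z < (max M 2 : ℕ)) : (intE z).length ≤ 3 * Nat.size M + 8 := by
  refine (length_intE_le z).trans ?_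
  have h1 : Nat.size z.natAbs ≤ Nat.size (max M 2) := size_mono (by omega)
  have h2 := size_max_two_le M
  omega

/-- `max p 2` in binary from `p` in unary. [folklore] -/
theorem maxTwoUnC : CodeFP unE natE (fun p => max p 2) := maxTwoC.comp natOfUn

/-- `max p 2` in unary from `p` in unary (through `min (max p 2) (p + 2)`). [folklore] -/
theorem maxTwoUnUnC : CodeFP unE unE (fun p => max p 2) :=
  (unOfNatMin.comp ((unSucc.comp unSucc).pair maxTwoUnC)).congr fun p => by
    show min (max p 2) (p + 1 + 1) = max p 2
    exact min_eq_left (by omega)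

/-- **`powMod p⁺ c e`** on codes, `p` and `e` unary (the step reduces modulo `max · 2`, so the
accumulator is a reduced residue on every input). [cite: AroraBarak2009, §1.3] -/
theorem powModC : CodeFP (pairE unE (pairE intE unE)) intE (fun t => powMod (max t.1 2) t.2.1 t.2.2) := by
  have hstep : CodeFP (pairE (pairE natE intE) (pairE unitE intE)) intE (fun t => t.2.2 * t.1.2 % ((max t.1.1 2 : ℕ) : ℤ)) :=
    (Literature.Algebra.EuclideanLattices.Khot.intEMod.comp ((intMul.comp ((snd _ _).snd'.pair (fst _ _).snd')).pair
      (intOfNat.comp (maxTwoC.comp (fst _ _).fst'))) :)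
  have hfold := foldl (σ := ℕ × ℤ) (α := Unit) (β := ℤ) (eσ := pairE natE intE) (eα := unitE) (eβ := intE)
    (step := fun s _ acc => acc * s.2 % ((max s.1 2 : ℕ) : ℤ)) (init := fun _ => (1 : ℤ)) hstep (const _ (1 : ℤ))
    (3 * X + 8) (fun s l₁ l₂ => by
      obtain ⟨P, c⟩ := s
      change (intE (l₁.foldl (fun acc (_ : Unit) => acc * c % ((max P 2 : ℕ) : ℤ)) 1)).length ≤ _
      have hrun : l₁.foldl (fun acc (_ : Unit) => acc * c % ((max P 2 : ℕ) : ℤ)) 1 = powMod (max P 2) c l₁.length := by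
        rw [powMod, ← CodeFP.eq_replicate_unit l₁]
      rw [hrun]
      simp only [pairE_apply, length_boolPair, length_natE, eval_add, eval_mul, eval_X, eval_ofNat]
      have hP : 0 < max P 2 := lt_of_lt_of_le (by norm_num) (le_max_right _ _)
      rcases powMod_bounds' hP c l₁.length with ⟨h0, hlt⟩ | h1
      · have := length_intE_le_of_lt_max h0 hlt; omega
      · rw [h1]
        have : (intE 1).length ≤ 3 * Nat.size 1 + 2 := length_intE_le 1
        have h2 : Nat.size 1 = 1 := by decide
        omega)
  exact (hfold.comp (((natOfUn.comp (fst _ _)).pair (snd _ _).fst').pair (replicateUnit.comp (snd _ _).snd'))).congr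
    fun t => by
      show (List.replicate t.2.2 ()).foldl (fun acc (_ : Unit) => acc * t.2.1 % ((max (id t.1) 2 : ℕ) : ℤ)) 1 = _
      rw [powMod]; rfl

/-- **`invMod p⁺ c`** on codes, `p` unary (exponent `p⁺ - 2` in unary). [cite: AroraBarak2009, §1.3] -/
theorem invModC : CodeFP (pairE unE intE) intE (fun t => invMod (max t.1 2) t.2) := by
  have hexp : CodeFP (pairE unE intE) unE (fun t => max t.1 2 - 2) :=
    ((unSubLen unitE).comp ((maxTwoUnUnC.comp (fst _ _)).pair (const _ [(), ()]))).congr fun _ => rfl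
  have hpow : CodeFP (pairE unE intE) intE (fun t => powMod (max t.1 2) t.2 (max t.1 2 - 2)) :=
    (powModC.comp ((fst _ _).pair ((snd _ _).pair hexp))).congr fun _ => rfl
  exact (Literature.Algebra.EuclideanLattices.Khot.intEMod.comp (hpow.pair (intOfNat.comp (maxTwoUnC.comp (fst _ _))))).congr
    fun _ => rfl

/-- The encoder of coefficient lists. -/
local notation "L" => rawE intE

/-- **`monicizer p⁺ a`** on codes. [cite: KnuthTAOCP2, §4.6.1] -/
theorem monicizerC : CodeFP (pairE unE L) intE (fun t => monicizer (max t.1 2) t.2) :=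
  (invModC.comp ((fst _ _).pair (lastEntryC.comp (snd _ _)))).congr fun _ => rfl

/-- **`monicize p⁺ a`** on codes. [cite: KnuthTAOCP2, §4.6.1] -/
theorem monicizeC : CodeFP (pairE unE L) L (fun t => monicize (max t.1 2) t.2) :=
  (pnormC.comp ((maxTwoUnC.comp (fst _ _)).pair (pscaleC.comp (monicizerC.pair (snd _ _))))).congr fun _ => rfl

/-- The encoder of the state of the extended Euclidean algorithm. -/
local notation "XS" => pairE (pairE (rawE intE) (rawE intE)) (pairE (pairE (rawE intE) (rawE intE)) (pairE (rawE intE) (rawE intE)))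

/-- **One step of the extended Euclidean algorithm modulo `p⁺`** on codes. [cite: KnuthTAOCP2, §4.6.1] -/
theorem xgcdStepC : CodeFP (pairE unE XS) XS (fun t => xgcdStep (max t.1 2) t.2) := by
  -- projections of `(p, ((r₀, r₁), (s₀, s₁), (t₀, t₁)))`
  have hp : CodeFP (pairE unE XS) unE (fun t => t.1) := (fst _ _ :)
  have hP : CodeFP (pairE unE XS) natE (fun t => max t.1 2) := (maxTwoUnC.comp hp :)
  have hr0 : CodeFP (pairE unE XS) L (fun t => t.2.1.1) := ((snd _ _).fst'.fst' :)
  have hr1 : CodeFP (pairE unE XS) L (fun t => t.2.1.2) := ((snd _ _).fst'.snd' :)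
  have hs0 : CodeFP (pairE unE XS) L (fun t => t.2.2.1.1) := ((snd _ _).snd'.fst'.fst' :)
  have hs1 : CodeFP (pairE unE XS) L (fun t => t.2.2.1.2) := ((snd _ _).snd'.fst'.snd' :)
  have ht0 : CodeFP (pairE unE XS) L (fun t => t.2.2.2.1) := ((snd _ _).snd'.snd'.fst' :)
  have ht1 : CodeFP (pairE unE XS) L (fun t => t.2.2.2.2) := ((snd _ _).snd'.snd'.snd' :)
  -- the step data
  have hc : CodeFP (pairE unE XS) intE (fun t => monicizer (max t.1 2) t.2.1.2) := (monicizerC.comp (hp.pair hr1) :)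
  have hm : CodeFP (pairE unE XS) L (fun t => monicize (max t.1 2) t.2.1.2) := (monicizeC.comp (hp.pair hr1) :)
  have hqr : CodeFP (pairE unE XS) (pairE L L) (fun t => pdivmod (max t.1 2) t.2.1.1 (monicize (max t.1 2) t.2.1.2)) :=
    (pdivmodC.comp ((natOfUn.comp hp).pair (hr0.pair hm))).congr fun _ => rfl
  have hs1' : CodeFP (pairE unE XS) L (fun t => pnorm (max t.1 2) (pscale (monicizer (max t.1 2) t.2.1.2) t.2.2.1.2)) :=
    (pnormC.comp (hP.pair (pscaleC.comp (hc.pair hs1))) :)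
  have ht1' : CodeFP (pairE unE XS) L (fun t => pnorm (max t.1 2) (pscale (monicizer (max t.1 2) t.2.1.2) t.2.2.2.2)) :=
    (pnormC.comp (hP.pair (pscaleC.comp (hc.pair ht1))) :)
  have hsn : CodeFP (pairE unE XS) L (fun t => pnorm (max t.1 2) (psub t.2.2.1.1
      (pmul (pdivmod (max t.1 2) t.2.1.1 (monicize (max t.1 2) t.2.1.2)).1 (pnorm (max t.1 2) (pscale (monicizer (max t.1 2) t.2.1.2) t.2.2.1.2))))) :=
    (pnormC.comp (hP.pair (psubC.comp (hs0.pair (pmulC.comp (hqr.fst'.pair hs1'))))) :)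
  have htn : CodeFP (pairE unE XS) L (fun t => pnorm (max t.1 2) (psub t.2.2.2.1
      (pmul (pdivmod (max t.1 2) t.2.1.1 (monicize (max t.1 2) t.2.1.2)).1 (pnorm (max t.1 2) (pscale (monicizer (max t.1 2) t.2.1.2) t.2.2.2.2))))) :=
    (pnormC.comp (hP.pair (psubC.comp (ht0.pair (pmulC.comp (hqr.fst'.pair ht1'))))) :)
  have hrn : CodeFP (pairE unE XS) L (fun t => pnorm (max t.1 2) (pdivmod (max t.1 2) t.2.1.1 (monicize (max t.1 2) t.2.1.2)).2) :=
    (pnormC.comp (hP.pair hqr.snd') :)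
  have hact : CodeFP (pairE unE XS) XS (fun t =>
      ((monicize (max t.1 2) t.2.1.2, pnorm (max t.1 2) (pdivmod (max t.1 2) t.2.1.1 (monicize (max t.1 2) t.2.1.2)).2),
        (pnorm (max t.1 2) (pscale (monicizer (max t.1 2) t.2.1.2) t.2.2.1.2),
          pnorm (max t.1 2) (psub t.2.2.1.1 (pmul (pdivmod (max t.1 2) t.2.1.1 (monicize (max t.1 2) t.2.1.2)).1
            (pnorm (max t.1 2) (pscale (monicizer (max t.1 2) t.2.1.2) t.2.2.1.2))))),
        (pnorm (max t.1 2) (pscale (monicizer (max t.1 2) t.2.1.2) t.2.2.2.2),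
          pnorm (max t.1 2) (psub t.2.2.2.1 (pmul (pdivmod (max t.1 2) t.2.1.1 (monicize (max t.1 2) t.2.1.2)).1
            (pnorm (max t.1 2) (pscale (monicizer (max t.1 2) t.2.1.2) t.2.2.2.2))))))) :=
    ((hm.pair hrn).pair ((hs1'.pair hsn).pair (ht1'.pair htn)) :)
  have htest : CodeFP (pairE unE XS) bitE (fun t => t.2.1.2.isEmpty) := ((rawIsEmpty intE).comp hr1 :)
  refine (htest.ite (snd _ _) hact).congr fun t => ?_
  obtain ⟨p, ⟨r₀, r₁⟩, ⟨s₀, s₁⟩, ⟨t₀, t₁⟩⟩ := t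
  by_cases h : r₁ = []
  · subst h; simp [xgcdStep]
  · rw [show (List.isEmpty r₁) = false from List.isEmpty_eq_false_iff.2 h]
    simp only [Bool.false_eq_true, ↓reduceIte]
    rw [xgcdStep_eq h]

/-! ### Unconditional sizes along the Euclidean loop -/

/-- The size invariant of the loop: all six lists reduced modulo `p'`, the remainders of length
`≤ R`, the Bezout coefficients of length `≤ S`. [folklore] -/
def XSize (p' R S : ℕ) (st : XgcdState) : Prop :=
  (Reduced p' st.1.1 ∧ Reduced p' st.1.2 ∧ Reduced p' st.2.1.1 ∧ Reduced p' st.2.1.2 ∧ Reduced p' st.2.2.1 ∧ Reduced p' st.2.2.2) ∧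
    st.1.1.length ≤ R ∧ st.1.2.length ≤ R ∧
    st.2.1.1.length ≤ S ∧ st.2.1.2.length ≤ S ∧ st.2.2.1.length ≤ S ∧ st.2.2.2.length ≤ S

/-- `monicize` does not lengthen. [folklore] -/
theorem length_monicize_le (p : ℕ) (a : List ℤ) : (monicize p a).length ≤ a.length :=
  (length_pnorm_le _).trans (by rw [pscale, List.length_map])

/-- **One step keeps the size invariant**, with `S ← S + R + 1` (`p' ≥ 1`). [folklore] -/
theorem xsize_step {p' R S : ℕ} (hp : 0 < p') {st : XgcdState} (h : XSize p' R S st) : XSize p' R (S + R + 1) (xgcdStep p' st) := by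
  obtain ⟨⟨r₀, r₁⟩, ⟨s₀, s₁⟩, ⟨t₀, t₁⟩⟩ := st
  obtain ⟨⟨n1, n2, n3, n4, n5, n6⟩, l1', l2', l3', l4', l5', l6'⟩ := h
  dsimp only at n1 n2 n3 n4 n5 n6 l1' l2' l3' l4' l5' l6'
  by_cases h0 : r₁ = []
  · subst h0
    refine ⟨⟨n1, n2, n3, n4, n5, n6⟩, l1', l2', ?_, ?_, ?_, ?_⟩ <;> simp [xgcdStep] <;> omega
  · rw [xgcdStep_eq h0]
    have hm := length_monicize_le p' r₁
    have hq := length_pdivmod_fst_le p' r₀ (monicize p' r₁)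
    have hr := length_pdivmod_snd_le p' r₀ (monicize p' r₁)
    have hs1 : (pnorm p' (pscale (monicizer p' r₁) s₁)).length ≤ S := (length_pnorm_le _).trans (by rw [pscale, List.length_map]; exact l4')
    have ht1 : (pnorm p' (pscale (monicizer p' r₁) t₁)).length ≤ S := (length_pnorm_le _).trans (by rw [pscale, List.length_map]; exact l6')
    refine ⟨⟨(normal_pnorm hp _).1, (normal_pnorm hp _).1, (normal_pnorm hp _).1, (normal_pnorm hp _).1, (normal_pnorm hp _).1,
      (normal_pnorm hp _).1⟩, hm.trans l2', (length_pnorm_le _).trans (hr.trans l1'), hs1.trans (by omega), ?_, ht1.trans (by omega), ?_⟩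
    · refine (length_pnorm_le _).trans ?_
      rw [length_psub]
      refine max_le (l3'.trans (by omega)) ((length_pmul_le _ _).trans ?_)
      omega
    · refine (length_pnorm_le _).trans ?_
      rw [length_psub]
      refine max_le (l5'.trans (by omega)) ((length_pmul_le _ _).trans ?_)
      omega

/-- The initial state has `R = max |a| |b|`, `S = 1`. [folklore] -/
theorem xsize_init {p' : ℕ} (hp : 0 < p') (a b : List ℤ) : XSize p' (max a.length b.length) 1 (xgcdInit p' a b) := by
  refine ⟨⟨(normal_pnorm hp _).1, (normal_pnorm hp _).1, (normal_pnorm hp _).1, fun _ h => by simp [xgcdInit] at h,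
    fun _ h => by simp [xgcdInit] at h, (normal_pnorm hp _).1⟩, ?_, ?_, ?_, by simp [xgcdInit], by simp [xgcdInit], ?_⟩
  · exact (length_pnorm_le _).trans (le_max_left _ _)
  · exact (length_pnorm_le _).trans (le_max_right _ _)
  · exact (length_pnorm_le _).trans (by simp)
  · exact (length_pnorm_le _).trans (by simp)

/-- **The run**: after `j` steps (any number, any input), `S ≤ 1 + j (R + 1)`. [folklore] -/
theorem xsize_run {p' : ℕ} (hp : 0 < p') (a b : List ℤ) (u : List Unit) :
    XSize p' (max a.length b.length) (1 + u.length * (max a.length b.length + 1))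
      (u.foldl (fun st _ => xgcdStep p' st) (xgcdInit p' a b)) := by
  induction u using List.reverseRecOn with
  | nil => simpa using xsize_init hp a b
  | append_singleton u x ih =>
    rw [List.foldl_append, List.foldl_cons, List.foldl_nil, List.length_append, List.length_singleton]
    have := xsize_step hp ih
    have heq : 1 + u.length * (max a.length b.length + 1) + max a.length b.length + 1 = 1 + (u.length + 1) * (max a.length b.length + 1) := by ring
    rw [heq] at this
    exact this

/-- Code length of one reduced list of the state. [folklore] -/
theorem length_code_state_le {p Lc : ℕ} {x : List ℤ} (hx : Reduced (max p 2) x) (hlen : x.length ≤ (Lc + 1) ^ 2) (hp : p ≤ Lc) :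
    (rawE intE x).length ≤ 30 * (Lc + 1) ^ 4 := by
  refine (length_rawE_intE_le_of_reduced hx).trans ?_
  have h1 : Nat.size x.length ≤ (Lc + 1) ^ 2 := (Nat.size_le.2 (Nat.lt_two_pow_self)).trans hlen
  have h2 : Nat.size (max p 2) ≤ Lc + 2 := (size_max_two_le p).trans (by have := Nat.size_le.2 (Nat.lt_two_pow_self (n := p)); omega)
  set A := Lc + 1 with hA
  have hA1 : 1 ≤ A := by omega
  have h3 : A ^ 3 ≤ A ^ 4 := Nat.pow_le_pow_right hA1 (by norm_num)
  have h4 : A ^ 2 ≤ A ^ 4 := Nat.pow_le_pow_right hA1 (by norm_num)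
  have hexp : A ^ 2 * (6 * (A ^ 2 + (A + 1)) + 6) = 6 * A ^ 4 + 6 * A ^ 3 + 12 * A ^ 2 := by ring
  calc x.length * (6 * (Nat.size x.length + Nat.size (max p 2)) + 6)
      ≤ A ^ 2 * (6 * (A ^ 2 + (A + 1)) + 6) := Nat.mul_le_mul hlen (by omega)
    _ ≤ 30 * A ^ 4 := by rw [hexp]; omega

/-- **The extended gcd modulo `p⁺`** on codes: `(p, a, b) ↦ pxgcd p⁺ a b`, `p` unary (fold over
`|b| + 1` ticks with the state of `xsize_run`, then the final normalisation).
[cite: KnuthTAOCP2, §4.6.1] [cite: AroraBarak2009, §1.3] -/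
theorem pxgcdC : CodeFP (pairE unE (pairE L L)) (pairE L (pairE L L)) (fun t => pxgcd (max t.1 2) t.2.1 t.2.2) := by
  -- the run as a fold with context `σ = (p, (a, b))`
  have hstep : CodeFP (pairE (pairE unE (pairE L L)) (pairE unitE XS)) XS (fun t => xgcdStep (max t.1.1 2) t.2.2) :=
    (xgcdStepC.comp ((fst _ _).fst'.pair (snd _ _).snd') :)
  have hone : CodeFP (pairE unE (pairE L L)) L (fun s => pnorm (max s.1 2) [1]) := (pnormC.comp ((maxTwoUnC.comp (fst _ _)).pair (const _ [(1 : ℤ)])) :)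
  have hinit : CodeFP (pairE unE (pairE L L)) XS (fun s => xgcdInit (max s.1 2) s.2.1 s.2.2) :=
    (((pnormC.comp ((maxTwoUnC.comp (fst _ _)).pair (snd _ _).fst')).pair (pnormC.comp ((maxTwoUnC.comp (fst _ _)).pair (snd _ _).snd'))).pair
      ((hone.pair (const _ ([] : List ℤ))).pair ((const _ ([] : List ℤ)).pair hone))).congr fun _ => rfl
  have hfold := foldl (σ := ℕ × (List ℤ × List ℤ)) (α := Unit) (β := XgcdState) (eσ := pairE unE (pairE L L)) (eα := unitE) (eβ := XS)
    (step := fun s _ st => xgcdStep (max s.1 2) st) (init := fun s => xgcdInit (max s.1 2) s.2.1 s.2.2) hstep hinit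
    (464 * (X + 1) ^ 4) (fun s l₁ l₂ => by
      obtain ⟨p, a, b⟩ := s
      change (pairE (pairE L L) (pairE (pairE L L) (pairE L L)) (l₁.foldl (fun st (_ : Unit) => xgcdStep (max p 2) st) (xgcdInit (max p 2) a b))).length ≤ _
      set Lc := (pairE (pairE unE (pairE L L)) (rawE unitE) ((p, a, b), l₁ ++ l₂)).length with hLc
      have hP : 0 < max p 2 := lt_of_lt_of_le (by norm_num) (le_max_right _ _)
      obtain ⟨⟨n1, n2, n3, n4, n5, n6⟩, l1', l2', l3', l4', l5', l6'⟩ := xsize_run hP a b l₁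
      set st := l₁.foldl (fun st (_ : Unit) => xgcdStep (max p 2) st) (xgcdInit (max p 2) a b)
      have hLa : a.length ≤ Lc := by
        rw [hLc]; simp only [pairE_apply, length_boolPair]; have := length_le_code a; omega
      have hLb : b.length ≤ Lc := by
        rw [hLc]; simp only [pairE_apply, length_boolPair]; have := length_le_code b; omega
      have hLu : l₁.length ≤ Lc := by
        rw [hLc]; simp only [pairE_apply, length_boolPair]
        have := length_le_length_rawE unitE (l₁ ++ l₂); rw [List.length_append] at this; omega
      have hLp : p ≤ Lc := by rw [hLc]; simp only [pairE_apply, length_boolPair, length_unE]; omega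
      have hR : max a.length b.length ≤ Lc := max_le hLa hLb
      have hS : 1 + l₁.length * (max a.length b.length + 1) ≤ (Lc + 1) ^ 2 := by nlinarith
      have hR2 : max a.length b.length ≤ (Lc + 1) ^ 2 := hR.trans (by nlinarith)
      have e1 := length_code_state_le n1 (l1'.trans hR2) hLp
      have e2 := length_code_state_le n2 (l2'.trans hR2) hLp
      have e3 := length_code_state_le n3 (l3'.trans hS) hLp
      have e4 := length_code_state_le n4 (l4'.trans hS) hLp
      have e5 := length_code_state_le n5 (l5'.trans hS) hLp
      have e6 := length_code_state_le n6 (l6'.trans hS) hLp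
      have hq1 : 1 ≤ (Lc + 1) ^ 4 := Nat.one_le_pow _ _ (by omega)
      simp only [pairE_apply, length_boolPair, eval_mul, eval_pow, eval_add, eval_X, eval_ofNat, eval_one]
      omega)
  have hrun : CodeFP (pairE unE (pairE L L)) XS (fun t => xgcdRun (max t.1 2) t.2.1 t.2.2 (t.2.2.length + 1)) :=
    (hfold.comp ((CodeFP.id _).pair (replicateUnit.comp (unSucc.comp ((ulength intE).comp (snd _ _).snd'))))).congr fun t => by
      show (List.replicate (t.2.2.length + 1) ()).foldl (fun st (_ : Unit) => xgcdStep (max (id t).1 2) st) (xgcdInit (max (id t).1 2) (id t).2.1 (id t).2.2) = _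
      rfl
  -- the final normalisation
  have hst : CodeFP (pairE unE (pairE L L)) (pairE unE L) (fun t => (t.1, (xgcdRun (max t.1 2) t.2.1 t.2.2 (t.2.2.length + 1)).1.1)) :=
    ((fst _ _).pair hrun.fst'.fst' :)
  have hc : CodeFP (pairE unE (pairE L L)) intE (fun t => monicizer (max t.1 2) (xgcdRun (max t.1 2) t.2.1 t.2.2 (t.2.2.length + 1)).1.1) :=
    (monicizerC.comp hst :)
  have hP : CodeFP (pairE unE (pairE L L)) natE (fun t => max t.1 2) := (maxTwoUnC.comp (fst _ _) :)
  refine ((monicizeC.comp hst).pair ((pnormC.comp (hP.pair (pscaleC.comp (hc.pair hrun.snd'.fst'.fst')))).pair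
    (pnormC.comp (hP.pair (pscaleC.comp (hc.pair hrun.snd'.snd'.fst')))))).congr fun t => ?_
  rfl

/-- **The gcd modulo `p⁺`** on codes. [cite: KnuthTAOCP2, §4.6.1] -/
theorem pgcdC : CodeFP (pairE unE (pairE L L)) L (fun t => pgcd (max t.1 2) t.2.1 t.2.2) := pxgcdC.fst'

end LLLFactoring

end Literature.Computability.Complexity
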